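import Mathlib
import HarnessLib
import Summits.NavierStokesRegularity.NavierStokesRegularity.Theorems.PoloidalWindowDoorLrcModEntireSheetCauchyUniqueness

/-!
# Route `PoloidalWindowDoor`, item `LrcModEntire` (stmt-NavierStokesRegularity-20428), cell (Q4) of the (TH) column —
# FLATTENING THE WEB SHEET, I: tools (frame isometry, flattened slice law, shear by the web)
# (brick W0 of LEAD memo T2B-g16 §3/§6(iii), first half)

Cell ns-regularity-ideate, LEAD-lineage seat ns-poloidal-K2-p3 g16 (`--supports stmt-NavierStokesRegularity-20428`).

Flat calculus over `…SheetCauchyUniqueness`: `sheetOp_pdS_eq_zero` (`∂_s` commutes with the flattened slice operator);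
`sheetOp_frame_eq_zero` (the frame isometry `L_e(s,n,z) = s·e + n·Je + z·e₂` turns `∂₂²θ = −μ(x₂)(∂₀²θ + ∂₁²θ)` into
`∂_z∂_zΘ + μ(∂_n∂_nΘ + ∂_s∂_sΘ) = 0`, by rotation invariance `bilin_frame_trace`); `sheetOp_shear_eq_zero` (the shear
`Ψ_d(s,n,z) = (s, n + d(z), z)` gives `∂_z∂_zH − 2d′∂_z∂_nH − d″∂_nH + (d′² + μ)∂_n∂_nH + μ∂_s∂_sH = 0` for `H = K ∘ Ψ_d`).

WHAT THIS IS NOT: not a claim about Navier–Stokes regularity; a calculus brick (bears_on LADDER-NS N0 via item 20428).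
-/

noncomputable section

set_option linter.dupNamespace false
set_option linter.unusedVariables false

namespace Summit.NavierStokesRegularity.NavierStokesRegularity.Theorems.PoloidalWindowDoorLrcModEntireSheetFlattenTools

open Set Function Filter Topology
open scoped ContDiff
open Summit.NavierStokesRegularity.NavierStokesRegularity.Theorems.PoloidalWindowDoorLrcModEntireSheetCauchyUniqueness

/-- **`∂_s` commutes with the flattened slice operator**: if `P H = 0` on the open slab then `P(∂_sH) = 0` there
(twin of `sheetOp_pdN_eq_zero`). -/
theorem sheetOp_pdS_eq_zero {I : Set ℝ} (hI : IsOpen I) {A B Q μ : ℝ → ℝ}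
    (hA : ∀ z ∈ I, DifferentiableAt ℝ A z) (hB : ∀ z ∈ I, DifferentiableAt ℝ B z)
    (hQ : ∀ z ∈ I, DifferentiableAt ℝ Q z) (hμ : ∀ z ∈ I, DifferentiableAt ℝ μ z)
    {H : ℝ × ℝ × ℝ → ℝ} (hH : ContDiffOn ℝ ∞ H (slab I))
    (hpde : ∀ p ∈ slab I, sheetOp A B Q μ H p = 0) :
    ∀ p ∈ slab I, sheetOp A B Q μ (pd eS H) p = 0 := by
  intro p hp
  have hS0 : eS.2.2 = 0 := rfl
  have hZ := contDiffOn_pd hI hH eZ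
  have hNs := contDiffOn_pd hI hH eN
  have hSs := contDiffOn_pd hI hH eS
  have hZZ := contDiffOn_pd hI hZ eZ
  have hZN := contDiffOn_pd hI hNs eZ
  have hNN := contDiffOn_pd hI hNs eN
  have hSS := contDiffOn_pd hI hSs eS
  have hzero : pd eS (sheetOp A B Q μ H) p = 0 := by
    have h : sheetOp A B Q μ H =ᶠ[𝓝 p] fun _ => 0 :=
      Filter.eventuallyEq_of_mem ((isOpen_slab hI).mem_nhds hp) fun q hq => hpde q hq
    rw [pd_congr_of_eventuallyEq eS h]
    simp [pd]
  have hd1 : DifferentiableAt ℝ (pd eZ (pd eZ H)) p := differentiableAt_of_slab hI hZZ hp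
  have hcoef : ∀ {c : ℝ → ℝ}, (∀ z ∈ I, DifferentiableAt ℝ c z) → ∀ {K : ℝ × ℝ × ℝ → ℝ}, ContDiffOn ℝ ∞ K (slab I) →
      DifferentiableAt ℝ (fun q : ℝ × ℝ × ℝ => c q.2.2 * K q) p := by
    intro c hc K hK
    have hproj : DifferentiableAt ℝ (fun q : ℝ × ℝ × ℝ => q.2.2) p := differentiableAt_snd.comp _ differentiableAt_snd
    exact ((hc p.2.2 hp).comp p hproj).mul (differentiableAt_of_slab hI hK hp)
  have hd2 := hcoef hA hZN
  have hd3 := hcoef hB hNs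
  have hd4 := hcoef hQ hNN
  have hd5 := hcoef hμ hSS
  have hsum : pd eS (sheetOp A B Q μ H) p =
      pd eS (pd eZ (pd eZ H)) p + pd eS (fun q : ℝ × ℝ × ℝ => A q.2.2 * pd eZ (pd eN H) q) p +
        pd eS (fun q : ℝ × ℝ × ℝ => B q.2.2 * pd eN H q) p + pd eS (fun q : ℝ × ℝ × ℝ => Q q.2.2 * pd eN (pd eN H) q) p +
        pd eS (fun q : ℝ × ℝ × ℝ => μ q.2.2 * pd eS (pd eS H) q) p := by
    have hF : HasFDerivAt (sheetOp A B Q μ H)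
        (fderiv ℝ (pd eZ (pd eZ H)) p + fderiv ℝ (fun q : ℝ × ℝ × ℝ => A q.2.2 * pd eZ (pd eN H) q) p +
          fderiv ℝ (fun q : ℝ × ℝ × ℝ => B q.2.2 * pd eN H q) p +
          fderiv ℝ (fun q : ℝ × ℝ × ℝ => Q q.2.2 * pd eN (pd eN H) q) p +
          fderiv ℝ (fun q : ℝ × ℝ × ℝ => μ q.2.2 * pd eS (pd eS H) q) p) p :=
      (((hd1.hasFDerivAt.add hd2.hasFDerivAt).add hd3.hasFDerivAt).add hd4.hasFDerivAt).add hd5.hasFDerivAt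
    unfold pd
    rw [hF.fderiv]
    simp only [_root_.add_apply]
    rfl
  rw [hsum, pd_heightFun_mul hI hA hZN hS0 hp, pd_heightFun_mul hI hB hNs hS0 hp, pd_heightFun_mul hI hQ hNN hS0 hp,
    pd_heightFun_mul hI hμ hSS hS0 hp] at hzero
  have c1 : pd eS (pd eZ (pd eZ H)) p = pd eZ (pd eZ (pd eS H)) p := by
    rw [pd_comm hI hZ eS eZ hp]
    exact pd_congr_on_slab hI eZ (fun q hq => pd_comm hI hH eS eZ hq) hp
  have c2 : pd eS (pd eZ (pd eN H)) p = pd eZ (pd eN (pd eS H)) p := by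
    rw [pd_comm hI hNs eS eZ hp]
    exact pd_congr_on_slab hI eZ (fun q hq => pd_comm hI hH eS eN hq) hp
  have c3 : pd eS (pd eN H) p = pd eN (pd eS H) p := pd_comm hI hH eS eN hp
  have c4 : pd eS (pd eN (pd eN H)) p = pd eN (pd eN (pd eS H)) p := by
    rw [pd_comm hI hNs eS eN hp]
    exact pd_congr_on_slab hI eN (fun q hq => pd_comm hI hH eS eN hq) hp
  rw [c1, c2, c3, c4] at hzero
  simpa [sheetOp] using hzero

/-- A function vanishing along an `s`-line has vanishing `∂_s` there. -/
theorem pdS_eq_zero_of_vanish_on_line {K : ℝ × ℝ × ℝ → ℝ} {m z : ℝ} (hK : ∀ s : ℝ, K (s, m, z) = 0) {s : ℝ}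
    (hd : DifferentiableAt ℝ K (s, m, z)) : pd eS K (s, m, z) = 0 := by
  unfold pd
  have hline : HasDerivAt (fun t : ℝ => K ((s, m, z) + t • eS)) (fderiv ℝ K (s, m, z) eS) 0 := by
    have h1 : HasFDerivAt K (fderiv ℝ K (s, m, z)) ((s, m, z) + (0 : ℝ) • eS) := by simpa using hd.hasFDerivAt
    have h2 : HasDerivAt (fun t : ℝ => ((s, m, z) : ℝ × ℝ × ℝ) + t • eS) eS 0 := by
      simpa using ((hasDerivAt_id (0 : ℝ)).smul_const eS).const_add ((s, m, z) : ℝ × ℝ × ℝ)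
    exact h1.comp_hasDerivAt 0 h2
  have hzero : (fun t : ℝ => K ((s, m, z) + t • eS)) = fun _ => 0 := by
    funext t
    have : ((s, m, z) : ℝ × ℝ × ℝ) + t • eS = (s + t, m, z) := by ext <;> simp [eS]
    rw [this]; exact hK _
  rw [hzero] at hline; exact hline.unique (hasDerivAt_const 0 (0 : ℝ)) |>.symm ▸ rfl

/-! ### The frame isometry `L(s,n,z) = s·e + n·Je + z·e₂` and the flattened field `Θ = θ ∘ L` -/

/-- Third basis vector `e₂` of `ℝ³`. -/
def e2 : EuclideanSpace ℝ (Fin 3) := EuclideanSpace.single 2 (1 : ℝ)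

/-- The horizontal quarter-turn `Je = (−e₁, e₀, 0)` of a vector `e`. -/
def Jvec (e : EuclideanSpace ℝ (Fin 3)) : EuclideanSpace ℝ (Fin 3) := WithLp.toLp 2 ![-(e 1), e 0, 0]

/-- The frame map `L_e(s,n,z) = s·e + n·Je + z·e₂` as a continuous linear map. -/
def frameCLM (e : EuclideanSpace ℝ (Fin 3)) : ℝ × ℝ × ℝ →L[ℝ] EuclideanSpace ℝ (Fin 3) :=
  (ContinuousLinearMap.fst ℝ ℝ (ℝ × ℝ)).smulRight e +
    ((ContinuousLinearMap.fst ℝ ℝ ℝ).comp (ContinuousLinearMap.snd ℝ ℝ (ℝ × ℝ))).smulRight (Jvec e) +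
    ((ContinuousLinearMap.snd ℝ ℝ ℝ).comp (ContinuousLinearMap.snd ℝ ℝ (ℝ × ℝ))).smulRight e2

/-- Auxiliary: `frameCLM_apply`. -/
theorem frameCLM_apply (e : EuclideanSpace ℝ (Fin 3)) (p : ℝ × ℝ × ℝ) :
    frameCLM e p = p.1 • e + p.2.1 • Jvec e + p.2.2 • e2 := by simp [frameCLM]

/-- Auxiliary: `frameCLM_eS`. -/
theorem frameCLM_eS (e : EuclideanSpace ℝ (Fin 3)) : frameCLM e eS = e := by simp [frameCLM_apply, eS]
/-- Auxiliary: `frameCLM_eN`. -/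
theorem frameCLM_eN (e : EuclideanSpace ℝ (Fin 3)) : frameCLM e eN = Jvec e := by simp [frameCLM_apply, eN]
/-- Auxiliary: `frameCLM_eZ`. -/
theorem frameCLM_eZ (e : EuclideanSpace ℝ (Fin 3)) : frameCLM e eZ = e2 := by simp [frameCLM_apply, eZ]

/-- The height coordinate of `L_e(s,n,z)` is `z` when `e` is horizontal. -/
theorem frameCLM_apply_two {e : EuclideanSpace ℝ (Fin 3)} (he2 : e 2 = 0) (p : ℝ × ℝ × ℝ) : frameCLM e p 2 = p.2.2 := by
  simp [frameCLM_apply, Jvec, e2, he2]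

/-- First derivatives of the flattened field: `∂_v(θ ∘ L)(p) = Dθ(Lp)[Lv]`. -/
theorem pd_comp_frame {θ : EuclideanSpace ℝ (Fin 3) → ℝ} (hθ : Differentiable ℝ θ) (e : EuclideanSpace ℝ (Fin 3))
    (v p : ℝ × ℝ × ℝ) : pd v (fun q => θ (frameCLM e q)) p = fderiv ℝ θ (frameCLM e p) (frameCLM e v) := by
  unfold pd
  have h := ((hθ (frameCLM e p)).hasFDerivAt.comp p (frameCLM e).hasFDerivAt)
  rw [show (fun q => θ (frameCLM e q)) = θ ∘ frameCLM e from rfl, h.fderiv]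
  rfl

/-- The first partial derivatives of the flattened field, as functions. -/
theorem pd_comp_frame_fun {θ : EuclideanSpace ℝ (Fin 3) → ℝ} (hθ : Differentiable ℝ θ) (e : EuclideanSpace ℝ (Fin 3))
    (v : ℝ × ℝ × ℝ) : pd v (fun q => θ (frameCLM e q)) = fun p => fderiv ℝ θ (frameCLM e p) (frameCLM e v) :=
  funext fun p => pd_comp_frame hθ e v p

/-- Second derivatives of the flattened field: `∂_w∂_v(θ ∘ L)(p) = D(x ↦ Dθ(x)[Lv])(Lp)[Lw]`. -/
theorem pd_pd_comp_frame {θ : EuclideanSpace ℝ (Fin 3) → ℝ} (hθ : ContDiff ℝ 2 θ) (e : EuclideanSpace ℝ (Fin 3))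
    (w v p : ℝ × ℝ × ℝ) :
    pd w (pd v (fun q => θ (frameCLM e q))) p =
      fderiv ℝ (fun x => fderiv ℝ θ x (frameCLM e v)) (frameCLM e p) (frameCLM e w) := by
  have hθd : Differentiable ℝ θ := hθ.differentiable (by norm_num)
  rw [pd_comp_frame_fun hθd e v]
  have hg : Differentiable ℝ (fun x => fderiv ℝ θ x (frameCLM e v)) :=
    ((hθ.fderiv_right (m := 1) (by norm_num)).differentiable (by norm_num)).clm_apply (differentiable_const _)
  exact pd_comp_frame hg e w p

/-! ### The flattened slice law -/

/-- Nested second derivatives are values of the second Fréchet derivative. -/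
theorem nested_eq_fderiv_fderiv {θ : EuclideanSpace ℝ (Fin 3) → ℝ} (hθ : ContDiff ℝ 2 θ) (x a b : EuclideanSpace ℝ (Fin 3)) :
    fderiv ℝ (fun y => fderiv ℝ θ y b) x a = fderiv ℝ (fderiv ℝ θ) x a b := by
  have hD : DifferentiableAt ℝ (fderiv ℝ θ) x :=
    ((hθ.fderiv_right (m := 1) (by norm_num)).differentiable (by norm_num)) x
  rw [fderiv_clm_apply hD (differentiableAt_const b)]
  simp

/-- A horizontal vector is the combination of `e₀, e₁` with its coordinates. -/
theorem horizontal_decomp {e : EuclideanSpace ℝ (Fin 3)} (he2 : e 2 = 0) :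
    e = (e 0) • EuclideanSpace.single 0 (1 : ℝ) + (e 1) • EuclideanSpace.single 1 (1 : ℝ) := by
  ext i; fin_cases i <;> simp [he2]

/-- `Je` in coordinates. -/
theorem Jvec_decomp (e : EuclideanSpace ℝ (Fin 3)) :
    Jvec e = (-(e 1)) • EuclideanSpace.single 0 (1 : ℝ) + (e 0) • EuclideanSpace.single 1 (1 : ℝ) := by
  ext i; fin_cases i <;> simp [Jvec]

/-- **Rotation invariance of the horizontal Laplacian** (bilinear form version): for a horizontal unit vector `e`,
`B(e,e) + B(Je,Je) = B(e₀,e₀) + B(e₁,e₁)`. -/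
theorem bilin_frame_trace (B : EuclideanSpace ℝ (Fin 3) →L[ℝ] EuclideanSpace ℝ (Fin 3) →L[ℝ] ℝ)
    {e : EuclideanSpace ℝ (Fin 3)} (he2 : e 2 = 0) (hunit : e 0 ^ 2 + e 1 ^ 2 = 1) :
    B e e + B (Jvec e) (Jvec e) =
      B (EuclideanSpace.single 0 (1 : ℝ)) (EuclideanSpace.single 0 (1 : ℝ)) +
        B (EuclideanSpace.single 1 (1 : ℝ)) (EuclideanSpace.single 1 (1 : ℝ)) := by
  set E0 : EuclideanSpace ℝ (Fin 3) := EuclideanSpace.single 0 (1 : ℝ)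
  set E1 : EuclideanSpace ℝ (Fin 3) := EuclideanSpace.single 1 (1 : ℝ)
  have hBe : B e e = e 0 ^ 2 * B E0 E0 + e 0 * e 1 * B E0 E1 + e 1 * e 0 * B E1 E0 + e 1 ^ 2 * B E1 E1 := by
    conv_lhs => rw [horizontal_decomp he2]
    simp only [map_add, map_smul, _root_.add_apply, _root_.smul_apply, smul_eq_mul]
    ring
  have hBJ : B (Jvec e) (Jvec e) =
      e 1 ^ 2 * B E0 E0 - e 1 * e 0 * B E0 E1 - e 0 * e 1 * B E1 E0 + e 0 ^ 2 * B E1 E1 := by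
    rw [Jvec_decomp e]
    simp only [map_add, map_smul, map_neg, _root_.add_apply, _root_.smul_apply, smul_eq_mul, neg_smul,
      _root_.neg_apply]
    ring
  rw [hBe, hBJ]; linear_combination (B E0 E0 + B E1 E1) * hunit

/-- **The flattened slice law.**  If `θ ∈ C²` satisfies the slice law `∂₂²θ = −μ(x₂)(∂₀²θ + ∂₁²θ)` on the slab
`{x₂ ∈ I}`, then `Θ = θ ∘ L_e` solves `∂_z∂_zΘ + μ(z)(∂_n∂_nΘ + ∂_s∂_sΘ) = 0` on the flat slab (`e` horizontal unit). -/
theorem sheetOp_frame_eq_zero {θ : EuclideanSpace ℝ (Fin 3) → ℝ} (hθ : ContDiff ℝ 2 θ) {μ : ℝ → ℝ} {I : Set ℝ}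
    (hlaw : ∀ x : EuclideanSpace ℝ (Fin 3), x 2 ∈ I →
      fderiv ℝ (fun y => fderiv ℝ θ y (EuclideanSpace.single 2 (1 : ℝ))) x (EuclideanSpace.single 2 (1 : ℝ)) =
        -μ (x 2) * (fderiv ℝ (fun y => fderiv ℝ θ y (EuclideanSpace.single 0 (1 : ℝ))) x (EuclideanSpace.single 0 (1 : ℝ)) +
          fderiv ℝ (fun y => fderiv ℝ θ y (EuclideanSpace.single 1 (1 : ℝ))) x (EuclideanSpace.single 1 (1 : ℝ))))
    {e : EuclideanSpace ℝ (Fin 3)} (he2 : e 2 = 0) (hunit : e 0 ^ 2 + e 1 ^ 2 = 1) :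
    ∀ p ∈ slab I, sheetOp (fun _ => 0) (fun _ => 0) μ μ (fun q => θ (frameCLM e q)) p = 0 := by
  intro p hp
  have hx2 : frameCLM e p 2 = p.2.2 := frameCLM_apply_two he2 p
  have hxI : frameCLM e p 2 ∈ I := by rw [hx2]; exact hp
  set x := frameCLM e p with hx
  set B := fderiv ℝ (fderiv ℝ θ) x with hB
  have hZZ : pd eZ (pd eZ (fun q => θ (frameCLM e q))) p = B e2 e2 := by
    rw [pd_pd_comp_frame hθ, frameCLM_eZ, nested_eq_fderiv_fderiv hθ]
  have hNN : pd eN (pd eN (fun q => θ (frameCLM e q))) p = B (Jvec e) (Jvec e) := by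
    rw [pd_pd_comp_frame hθ, frameCLM_eN, nested_eq_fderiv_fderiv hθ]
  have hSS : pd eS (pd eS (fun q => θ (frameCLM e q))) p = B e e := by
    rw [pd_pd_comp_frame hθ, frameCLM_eS, nested_eq_fderiv_fderiv hθ]
  have hl := hlaw x hxI
  rw [nested_eq_fderiv_fderiv hθ, nested_eq_fderiv_fderiv hθ, nested_eq_fderiv_fderiv hθ, hx2] at hl
  have htr := bilin_frame_trace B he2 hunit
  simp only [sheetOp, zero_mul, add_zero, hZZ, hNN, hSS]
  have he2' : e2 = EuclideanSpace.single 2 (1 : ℝ) := rfl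
  rw [he2', ← hB] at *
  rw [hl]
  linear_combination μ p.2.2 * htr

/-! ### The shear by the web: `H = K ∘ Ψ`, `Ψ(s,n,z) = (s, n + d(z), z)` -/

/-- The shear map `Ψ_d(s,n,z) = (s, n + d(z), z)`. -/
def shear (d : ℝ → ℝ) (p : ℝ × ℝ × ℝ) : ℝ × ℝ × ℝ := (p.1, p.2.1 + d p.2.2, p.2.2)

/-- The derivative of the shear map at height `z`: `(a,b,c) ↦ (a, b + d′(z)c, c)`. -/
def shearDeriv (d' : ℝ) : ℝ × ℝ × ℝ →L[ℝ] ℝ × ℝ × ℝ :=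
  (ContinuousLinearMap.fst ℝ ℝ (ℝ × ℝ)).prod
    ((((ContinuousLinearMap.fst ℝ ℝ ℝ).comp (ContinuousLinearMap.snd ℝ ℝ (ℝ × ℝ))) +
        d' • ((ContinuousLinearMap.snd ℝ ℝ ℝ).comp (ContinuousLinearMap.snd ℝ ℝ (ℝ × ℝ)))).prod
      ((ContinuousLinearMap.snd ℝ ℝ ℝ).comp (ContinuousLinearMap.snd ℝ ℝ (ℝ × ℝ))))

/-- Auxiliary: `shearDeriv_eS`. -/
theorem shearDeriv_eS (d' : ℝ) : shearDeriv d' eS = eS := by simp [shearDeriv, eS]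
/-- Auxiliary: `shearDeriv_eN`. -/
theorem shearDeriv_eN (d' : ℝ) : shearDeriv d' eN = eN := by simp [shearDeriv, eN]
/-- Auxiliary: `shearDeriv_eZ`. -/
theorem shearDeriv_eZ (d' : ℝ) : shearDeriv d' eZ = d' • eN + eZ := by simp [shearDeriv, eN, eZ]

/-- Auxiliary: `shear_mem_slab`. -/
theorem shear_mem_slab {d : ℝ → ℝ} {I : Set ℝ} {p : ℝ × ℝ × ℝ} (hp : p ∈ slab I) : shear d p ∈ slab I := hp

/-- Auxiliary: `hasFDerivAt_shear`. -/
theorem hasFDerivAt_shear {d : ℝ → ℝ} {p : ℝ × ℝ × ℝ} (hd : DifferentiableAt ℝ d p.2.2) :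
    HasFDerivAt (shear d) (shearDeriv (deriv d p.2.2)) p := by
  have h1 : HasFDerivAt (fun q : ℝ × ℝ × ℝ => q.1) (ContinuousLinearMap.fst ℝ ℝ (ℝ × ℝ)) p := hasFDerivAt_fst
  have h21 : HasFDerivAt (fun q : ℝ × ℝ × ℝ => q.2.1)
      ((ContinuousLinearMap.fst ℝ ℝ ℝ).comp (ContinuousLinearMap.snd ℝ ℝ (ℝ × ℝ))) p :=
    ((ContinuousLinearMap.fst ℝ ℝ ℝ).comp (ContinuousLinearMap.snd ℝ ℝ (ℝ × ℝ))).hasFDerivAt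
  have h22 : HasFDerivAt (fun q : ℝ × ℝ × ℝ => q.2.2)
      ((ContinuousLinearMap.snd ℝ ℝ ℝ).comp (ContinuousLinearMap.snd ℝ ℝ (ℝ × ℝ))) p :=
    ((ContinuousLinearMap.snd ℝ ℝ ℝ).comp (ContinuousLinearMap.snd ℝ ℝ (ℝ × ℝ))).hasFDerivAt
  have hdz : HasFDerivAt (fun q : ℝ × ℝ × ℝ => d q.2.2)
      (deriv d p.2.2 • ((ContinuousLinearMap.snd ℝ ℝ ℝ).comp (ContinuousLinearMap.snd ℝ ℝ (ℝ × ℝ)))) p := by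
    have hc : HasDerivAt d (deriv d p.2.2) ((fun q : ℝ × ℝ × ℝ => q.2.2) p) := hd.hasDerivAt
    exact hc.comp_hasFDerivAt p h22
  exact h1.prodMk ((h21.add hdz).prodMk h22)

/-- First derivatives of a sheared function: `∂_v(K ∘ Ψ)(p) = DK(Ψp)[Ψ′(p)v]`. -/
theorem pd_shear {I : Set ℝ} (hI : IsOpen I) {K : ℝ × ℝ × ℝ → ℝ} (hK : ContDiffOn ℝ ∞ K (slab I)) {d : ℝ → ℝ}
    {p : ℝ × ℝ × ℝ} (hp : p ∈ slab I) (hd : DifferentiableAt ℝ d p.2.2) (v : ℝ × ℝ × ℝ) :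
    pd v (fun q => K (shear d q)) p = fderiv ℝ K (shear d p) (shearDeriv (deriv d p.2.2) v) := by
  unfold pd
  have hKd : DifferentiableAt ℝ K (shear d p) := differentiableAt_of_slab hI hK (shear_mem_slab hp)
  have h := hKd.hasFDerivAt.comp p (hasFDerivAt_shear hd)
  rw [show (fun q => K (shear d q)) = K ∘ shear d from rfl, h.fderiv]
  rfl

/-- Auxiliary: `pd_shear_eS`. -/
theorem pd_shear_eS {I : Set ℝ} (hI : IsOpen I) {K : ℝ × ℝ × ℝ → ℝ} (hK : ContDiffOn ℝ ∞ K (slab I)) {d : ℝ → ℝ}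
    {p : ℝ × ℝ × ℝ} (hp : p ∈ slab I) (hd : DifferentiableAt ℝ d p.2.2) :
    pd eS (fun q => K (shear d q)) p = pd eS K (shear d p) := by
  rw [pd_shear hI hK hp hd, shearDeriv_eS]; rfl

/-- Auxiliary: `pd_shear_eN`. -/
theorem pd_shear_eN {I : Set ℝ} (hI : IsOpen I) {K : ℝ × ℝ × ℝ → ℝ} (hK : ContDiffOn ℝ ∞ K (slab I)) {d : ℝ → ℝ}
    {p : ℝ × ℝ × ℝ} (hp : p ∈ slab I) (hd : DifferentiableAt ℝ d p.2.2) :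
    pd eN (fun q => K (shear d q)) p = pd eN K (shear d p) := by
  rw [pd_shear hI hK hp hd, shearDeriv_eN]; rfl

/-- Auxiliary: `pd_shear_eZ`. -/
theorem pd_shear_eZ {I : Set ℝ} (hI : IsOpen I) {K : ℝ × ℝ × ℝ → ℝ} (hK : ContDiffOn ℝ ∞ K (slab I)) {d : ℝ → ℝ}
    {p : ℝ × ℝ × ℝ} (hp : p ∈ slab I) (hd : DifferentiableAt ℝ d p.2.2) :
    pd eZ (fun q => K (shear d q)) p = deriv d p.2.2 * pd eN K (shear d p) + pd eZ K (shear d p) := by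
  rw [pd_shear hI hK hp hd, shearDeriv_eZ, map_add, map_smul]
  rfl

/-- A sheared smooth function is smooth on the slab. -/
theorem contDiffOn_shear {I : Set ℝ} (hI : IsOpen I) {K : ℝ × ℝ × ℝ → ℝ} (hK : ContDiff ℝ ∞ K) {d : ℝ → ℝ}
    (hd : ContDiffOn ℝ ∞ d I) : ContDiffOn ℝ ∞ (fun q => K (shear d q)) (slab I) := by
  have hΨ : ContDiffOn ℝ ∞ (shear d) (slab I) := by
    have h1 : ContDiffOn ℝ ∞ (fun q : ℝ × ℝ × ℝ => q.1) (slab I) := contDiffOn_fst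
    have h22 : ContDiffOn ℝ ∞ (fun q : ℝ × ℝ × ℝ => q.2.2) (slab I) := (contDiff_snd.comp contDiff_snd).contDiffOn
    have h21 : ContDiffOn ℝ ∞ (fun q : ℝ × ℝ × ℝ => q.2.1) (slab I) := (contDiff_fst.comp contDiff_snd).contDiffOn
    have hdz : ContDiffOn ℝ ∞ (fun q : ℝ × ℝ × ℝ => d q.2.2) (slab I) := hd.comp h22 (fun q hq => hq)
    exact h1.prodMk ((h21.add hdz).prodMk h22)
  exact hK.comp_contDiffOn hΨ

/-- Product rule in the height direction: `∂_z(c(z)·M)(p) = c′(z)M(p) + c(z)∂_zM(p)`. -/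
theorem pd_eZ_heightFun_mul {c : ℝ → ℝ} {M : ℝ × ℝ × ℝ → ℝ} {p : ℝ × ℝ × ℝ} (hc : DifferentiableAt ℝ c p.2.2)
    (hM : DifferentiableAt ℝ M p) :
    pd eZ (fun q : ℝ × ℝ × ℝ => c q.2.2 * M q) p = deriv c p.2.2 * M p + c p.2.2 * pd eZ M p := by
  obtain ⟨s, n, z⟩ := p
  unfold pd
  have hproj : HasFDerivAt (fun q : ℝ × ℝ × ℝ => q.2.2)
      ((ContinuousLinearMap.snd ℝ ℝ ℝ).comp (ContinuousLinearMap.snd ℝ ℝ (ℝ × ℝ))) (s, n, z) :=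
    ((ContinuousLinearMap.snd ℝ ℝ ℝ).comp (ContinuousLinearMap.snd ℝ ℝ (ℝ × ℝ))).hasFDerivAt
  have hcz : HasFDerivAt (fun q : ℝ × ℝ × ℝ => c q.2.2)
      ((fderiv ℝ c z).comp ((ContinuousLinearMap.snd ℝ ℝ ℝ).comp (ContinuousLinearMap.snd ℝ ℝ (ℝ × ℝ)))) (s, n, z) :=
    HasFDerivAt.comp ((s, n, z) : ℝ × ℝ × ℝ) hc.hasFDerivAt hproj
  rw [fderiv_fun_mul hcz.differentiableAt hM, hcz.fderiv]
  simp only [_root_.add_apply, _root_.smul_apply, smul_eq_mul, ContinuousLinearMap.coe_comp, Function.comp_apply,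
    ContinuousLinearMap.coe_snd', eZ]
  have : (fderiv ℝ c z) (1 : ℝ) = deriv c z := by simp
  rw [this]
  ring

/-- **The sheared equation.**  If `K` solves `∂_z∂_zK + μ(∂_n∂_nK + ∂_s∂_sK) = 0` on the slab, then `H = K ∘ Ψ_d` solves
`∂_z∂_zH − 2d′∂_z∂_nH − d″∂_nH + (d′² + μ)∂_n∂_nH + μ∂_s∂_sH = 0` there. -/
theorem sheetOp_shear_eq_zero {I : Set ℝ} (hI : IsOpen I) {μ : ℝ → ℝ} {K : ℝ × ℝ × ℝ → ℝ} (hK : ContDiff ℝ ∞ K)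
    (hpde : ∀ p ∈ slab I, sheetOp (fun _ => 0) (fun _ => 0) μ μ K p = 0)
    {d : ℝ → ℝ} (hd : ContDiffOn ℝ ∞ d I) :
    ∀ p ∈ slab I, sheetOp (fun z => -2 * deriv d z) (fun z => -(deriv (deriv d) z)) (fun z => deriv d z ^ 2 + μ z) μ
      (fun q => K (shear d q)) p = 0 := by
  intro p hp
  have hz : p.2.2 ∈ I := hp
  have hKon : ContDiffOn ℝ ∞ K (slab I) := hK.contDiffOn
  -- derivatives of `d`
  have hdd : ∀ z ∈ I, DifferentiableAt ℝ d z := fun z hz =>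
    (hd.contDiffAt (hI.mem_nhds hz)).differentiableAt (by simp)
  have hd' : ContDiffOn ℝ ∞ (deriv d) I := by
    have h := hd.deriv_of_isOpen hI (m := ∞) (by simp)
    exact h
  have hdd' : ∀ z ∈ I, DifferentiableAt ℝ (deriv d) z := fun z hz =>
    (hd'.contDiffAt (hI.mem_nhds hz)).differentiableAt (by simp)
  -- smoothness of the pieces
  have hKN : ContDiff ℝ ∞ (pd eN K) := (hK.fderiv_right (m := ∞) (by norm_cast)).clm_apply contDiff_const
  have hKZ : ContDiff ℝ ∞ (pd eZ K) := (hK.fderiv_right (m := ∞) (by norm_cast)).clm_apply contDiff_const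
  have hKS : ContDiff ℝ ∞ (pd eS K) := (hK.fderiv_right (m := ∞) (by norm_cast)).clm_apply contDiff_const
  have hH := contDiffOn_shear hI hK hd
  have hHN := contDiffOn_shear hI hKN hd
  have hHZ := contDiffOn_shear hI hKZ hd
  have hHS := contDiffOn_shear hI hKS hd
  -- first-order formulas, as functions on the slab
  have fS : ∀ q ∈ slab I, pd eS (fun q => K (shear d q)) q = pd eS K (shear d q) := fun q hq =>
    pd_shear_eS hI hKon hq (hdd _ hq)
  have fN : ∀ q ∈ slab I, pd eN (fun q => K (shear d q)) q = pd eN K (shear d q) := fun q hq =>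
    pd_shear_eN hI hKon hq (hdd _ hq)
  have fZ : ∀ q ∈ slab I, pd eZ (fun q => K (shear d q)) q =
      (fun q : ℝ × ℝ × ℝ => deriv d q.2.2 * pd eN K (shear d q) + pd eZ K (shear d q)) q := fun q hq =>
    pd_shear_eZ hI hKon hq (hdd _ hq)
  -- second-order formulas at `p`
  set q₀ := shear d p with hq₀
  have hq₀s : q₀ ∈ slab I := shear_mem_slab hp
  have hSS : pd eS (pd eS (fun q => K (shear d q))) p = pd eS (pd eS K) q₀ := by
    rw [pd_congr_on_slab hI eS fS hp, pd_shear_eS hI hKS.contDiffOn hp (hdd _ hz)]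
  have hNN : pd eN (pd eN (fun q => K (shear d q))) p = pd eN (pd eN K) q₀ := by
    rw [pd_congr_on_slab hI eN fN hp, pd_shear_eN hI hKN.contDiffOn hp (hdd _ hz)]
  have hZN : pd eZ (pd eN (fun q => K (shear d q))) p = deriv d p.2.2 * pd eN (pd eN K) q₀ + pd eZ (pd eN K) q₀ := by
    rw [pd_congr_on_slab hI eZ fN hp, pd_shear_eZ hI hKN.contDiffOn hp (hdd _ hz)]
  have hN : pd eN (fun q => K (shear d q)) p = pd eN K q₀ := fN p hp
  have hZZ : pd eZ (pd eZ (fun q => K (shear d q))) p =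
      deriv (deriv d) p.2.2 * pd eN K q₀ +
        deriv d p.2.2 * (deriv d p.2.2 * pd eN (pd eN K) q₀ + pd eZ (pd eN K) q₀) +
        (deriv d p.2.2 * pd eN (pd eZ K) q₀ + pd eZ (pd eZ K) q₀) := by
    rw [pd_congr_on_slab hI eZ fZ hp]
    have hM1 : DifferentiableAt ℝ (fun q => pd eN K (shear d q)) p := differentiableAt_of_slab hI hHN hp
    have hM2 : DifferentiableAt ℝ (fun q => pd eZ K (shear d q)) p := differentiableAt_of_slab hI hHZ hp
    have hc : DifferentiableAt ℝ (fun q : ℝ × ℝ × ℝ => deriv d q.2.2 * pd eN K (shear d q)) p := by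
      have hproj : DifferentiableAt ℝ (fun q : ℝ × ℝ × ℝ => q.2.2) p := differentiableAt_snd.comp _ differentiableAt_snd
      exact (((hdd' _ hz).comp p hproj)).mul hM1
    have hsplit : pd eZ (fun q : ℝ × ℝ × ℝ => deriv d q.2.2 * pd eN K (shear d q) + pd eZ K (shear d q)) p =
        pd eZ (fun q : ℝ × ℝ × ℝ => deriv d q.2.2 * pd eN K (shear d q)) p + pd eZ (fun q => pd eZ K (shear d q)) p := by
      have h := (hc.hasFDerivAt.add hM2.hasFDerivAt).fderiv
      have h' := congrArg (fun L : ℝ × ℝ × ℝ →L[ℝ] ℝ => L eZ) h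
      simpa only [pd, _root_.add_apply, Pi.add_def] using h'
    rw [hsplit, pd_eZ_heightFun_mul (hdd' _ hz) hM1, pd_shear_eZ hI hKN.contDiffOn hp (hdd _ hz),
      pd_shear_eZ hI hKZ.contDiffOn hp (hdd _ hz)]
  -- symmetry `∂_n∂_zK = ∂_z∂_nK` at `q₀`
  have hsym : pd eN (pd eZ K) q₀ = pd eZ (pd eN K) q₀ := pd_comm hI hKon eN eZ hq₀s
  -- the equation for `K` at `q₀`
  have hKq := hpde q₀ hq₀s
  have hz₀ : q₀.2.2 = p.2.2 := rfl
  simp only [sheetOp, zero_mul, add_zero] at hKq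
  rw [hz₀] at hKq
  simp only [sheetOp, hZZ, hZN, hN, hNN, hSS, hsym]
  linear_combination hKq

end Summit.NavierStokesRegularity.NavierStokesRegularity.Theorems.PoloidalWindowDoorLrcModEntireSheetFlattenTools
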